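import Literature.NumberTheory.Weil1964.AdelicMetaplecticGenerators
import HarnessLib

/-!
# The dilation law of adelic chirp (Gauss) integrals

For `Φ : 𝔸_Fⁿ → ℂ`, a symmetric (or arbitrary) matrix `S ∈ M_n(𝔸_F)` and `g ∈ GL_n(𝔸_F)`, the
*chirp integral* `∫ ψ_F(q_S(x)) Φ(x) dν(x) = ∫ chirp F S Φ ∂ν` transforms under the twist
`Φ ↦ Φ(· g)` (`twist F g Φ`) by the substitution `x ↦ x g`:

* `integral_chirp_twist` — `∫ chirp S (twist g Φ) dν = |det g|_𝔸⁻¹ · ∫ chirp (g⁻¹ S g⁻ᵀ) Φ dν`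
  (Weil's relation `d(g)⁻¹ t(S) d(g) = t(g S gᵀ)`, tree `twist_chirp`, followed by the module of
  `x ↦ x g`, tree `integral_comp_vecMul`);
* `integral_chirp_toOp_leviPair` — the same law for Weil's Levi operator `d(a)` of the adelic
  metaplectic group, `ω(d(a))Φ = Φ(· (aᵀ)⁻¹)` (tree `coe_toOp_leviPair`):
  `∫ chirp S (ω(d(a))Φ) dν = |det a|_𝔸 · ∫ chirp (aᵀ S a) Φ dν`;
* `adelicPiFourier_twist`, `fourierLM_twistLM`, `fourierLM_comp_twistLM` — the **Weyl–Levi relation**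
  `𝓕 ∘ d(g) = |det g|_𝔸⁻¹ · d((g⁻¹)ᵀ) ∘ 𝓕` on `𝒮(𝔸_Fⁿ)` (tree `adelicPiFourier_comp_vecMul` at operator
  level), and `twistLM_comp_chirpLM` — `d(g)⁻¹ t(S) d(g) = t(g S gᵀ)` at operator level;
* `apply_chirpLM_twistLM_of_comp_fourierLM_eq` — the **Weyl flip**: for a linear functional `L` on
  `𝒮(𝔸_Fⁿ)` with `L ∘ 𝓕 = L`, `L(t(S) d(g) Φ) = |det g|_𝔸⁻¹ · L(d((g⁻¹)ᵀ) 𝓕[t(g⁻¹ S g⁻ᵀ) Φ])` — the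
  algebra reducing one ray of the Levi torus to the other in Weil's boundedness step (Thm. 4).

These are the change-of-variables identities behind the homogeneity of the Fourier coefficients
`b ↦ F*_Φ(b)` of Weil's Eisenstein-type measure under the Levi torus ([Weil1965] n° 46–52,
formulas (36)–(40): `ω(m(λ_t))` rescales the fibres `q_S = b`), used on the Eisenstein side of the
boundedness step (Weil 1965, Thm. 4) of the Siegel–Weil formula.

References: A. Weil, *Sur certains groupes d'opérateurs unitaires*, Acta Math. 111 (1964),
Chap. I n° 34 [Weil1964]; A. Weil, *Sur la formule de Siegel dans la théorie des groupes
classiques*, Acta Math. 113 (1965), n° 46–52 [Weil1965].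
-/

noncomputable section

open scoped Matrix NNReal
open NumberField MeasureTheory

namespace Literature.NumberTheory.Weil1964

open Literature.NumberTheory.Automorphic Literature.RepresentationTheory.HeisenbergGroup

variable (F : Type) [Field F] [NumberField F] {n : ℕ}
variable [MeasurableSpace (AdeleRing (𝓞 F) F)] [BorelSpace (AdeleRing (𝓞 F) F)]
variable (ν : Measure (Fin n → AdeleRing (𝓞 F) F)) [ν.IsAddHaarMeasure]

omit [MeasurableSpace (AdeleRing (𝓞 F) F)] [BorelSpace (AdeleRing (𝓞 F) F)] in
/-- `t(S)` and `d(g)` in the other order: `chirp S (twist g Φ) = twist g (chirp (g⁻¹ S g⁻ᵀ) Φ)`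
(Weil's `d(g)⁻¹ t(S') d(g) = t(g S' gᵀ)` with `S' = g⁻¹ S g⁻ᵀ`). [cite: Weil1964, Chap. I n° 34 p. 182–184] -/
theorem chirp_twist (g : GL (Fin n) (AdeleRing (𝓞 F) F)) (S : Matrix (Fin n) (Fin n) (AdeleRing (𝓞 F) F))
    (Φ : (Fin n → AdeleRing (𝓞 F) F) → ℂ) :
    chirp F S (twist F g Φ) =
      twist F g (chirp F (((g⁻¹ : GL (Fin n) (AdeleRing (𝓞 F) F)) : Matrix (Fin n) (Fin n) (AdeleRing (𝓞 F) F)) * S *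
        (((g⁻¹ : GL (Fin n) (AdeleRing (𝓞 F) F)) : Matrix (Fin n) (Fin n) (AdeleRing (𝓞 F) F)))ᵀ) Φ) := by
  rw [twist_chirp]
  congr 1
  symm
  rw [← Matrix.mul_assoc, ← Matrix.mul_assoc, ← Units.val_mul, mul_inv_cancel, Units.val_one, Matrix.one_mul,
    Matrix.mul_assoc, ← Matrix.transpose_mul, ← Units.val_mul, mul_inv_cancel, Units.val_one, Matrix.transpose_one,
    Matrix.mul_one]

/-- **Dilation law of chirp integrals**: `∫ ψ_F(q_S(x)) Φ(x g) dν(x) = |det g|_𝔸⁻¹ ∫ ψ_F(q_{g⁻¹ S g⁻ᵀ}(x)) Φ(x) dν(x)`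
(substitute `x ↦ x g⁻¹`; both sides are junk together when non-integrable). [cite: Weil1964, Chap. I n° 34 p. 182–184] -/
theorem integral_chirp_twist (g : GL (Fin n) (AdeleRing (𝓞 F) F)) (S : Matrix (Fin n) (Fin n) (AdeleRing (𝓞 F) F))
    (Φ : (Fin n → AdeleRing (𝓞 F) F) → ℂ) :
    ∫ x, chirp F S (twist F g Φ) x ∂ν =
      ((adelicAbsDet n F g⁻¹ : ℝ≥0) : ℝ) •
        ∫ x, chirp F (((g⁻¹ : GL (Fin n) (AdeleRing (𝓞 F) F)) : Matrix (Fin n) (Fin n) (AdeleRing (𝓞 F) F)) * S *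
          (((g⁻¹ : GL (Fin n) (AdeleRing (𝓞 F) F)) : Matrix (Fin n) (Fin n) (AdeleRing (𝓞 F) F)))ᵀ) Φ x ∂ν := by
  rw [chirp_twist]
  exact integral_comp_vecMul ν _ g

/-- The dilation law in the form `∫ chirp (g S gᵀ) (twist g Φ) dν = |det g|_𝔸⁻¹ ∫ chirp S Φ dν`. [cite: Weil1964, Chap. I n° 34 p. 182–184] -/
theorem integral_chirp_conj_twist (g : GL (Fin n) (AdeleRing (𝓞 F) F)) (S : Matrix (Fin n) (Fin n) (AdeleRing (𝓞 F) F))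
    (Φ : (Fin n → AdeleRing (𝓞 F) F) → ℂ) :
    ∫ x, chirp F ((g : Matrix (Fin n) (Fin n) (AdeleRing (𝓞 F) F)) * S *
        ((g : Matrix (Fin n) (Fin n) (AdeleRing (𝓞 F) F)))ᵀ) (twist F g Φ) x ∂ν =
      ((adelicAbsDet n F g⁻¹ : ℝ≥0) : ℝ) • ∫ x, chirp F S Φ x ∂ν := by
  rw [← twist_chirp]
  exact integral_comp_vecMul ν _ g

section Levi

variable (T : Matrix (Fin n) (Fin n) (AdeleRing (𝓞 F) F)) (hT : IsUnit T.det)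

/-- **Dilation law for Weil's Levi operator** `d(a)`, `ω(d(a))Φ = Φ(· (aᵀ)⁻¹)`:
`∫ ψ_F(q_S(x)) (ω(d(a))Φ)(x) dν(x) = |det a|_𝔸 ∫ ψ_F(q_{aᵀ S a}(x)) Φ(x) dν(x)` — the homogeneity of the
chirp integrals under the Levi torus behind Weil's formulas (36)–(40). [cite: Weil1965, n° 46–52] -/
theorem integral_chirp_toOp_leviPair (a : GL (Fin n) (AdeleRing (𝓞 F) F))
    (S : Matrix (Fin n) (Fin n) (AdeleRing (𝓞 F) F)) (Φ : piSchwartzBruhat F (Fin n)) :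
    ∫ x, chirp F S ((MpPsi.toOp (adelicSchrodinger F (Fin n) T) (leviPair F T hT a) Φ : piSchwartzBruhat F (Fin n)) :
        (Fin n → AdeleRing (𝓞 F) F) → ℂ) x ∂ν =
      ((adelicAbsDet n F a : ℝ≥0) : ℝ) •
        ∫ x, chirp F ((a : Matrix (Fin n) (Fin n) (AdeleRing (𝓞 F) F))ᵀ * S *
          (a : Matrix (Fin n) (Fin n) (AdeleRing (𝓞 F) F))) (Φ : (Fin n → AdeleRing (𝓞 F) F) → ℂ) x ∂ν := by
  rw [coe_toOp_leviPair, integral_chirp_twist]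
  have h1 : (trInv a)⁻¹ = (⟨((a : Matrix (Fin n) (Fin n) (AdeleRing (𝓞 F) F)))ᵀ,
      (((a⁻¹ : GL (Fin n) (AdeleRing (𝓞 F) F)) : Matrix (Fin n) (Fin n) (AdeleRing (𝓞 F) F)))ᵀ,
      (trInv a).inv_val, (trInv a).val_inv⟩ : GL (Fin n) (AdeleRing (𝓞 F) F)) :=
    Units.ext rfl
  have h2 : (((trInv a)⁻¹ : GL (Fin n) (AdeleRing (𝓞 F) F)) : Matrix (Fin n) (Fin n) (AdeleRing (𝓞 F) F)) =
      ((a : Matrix (Fin n) (Fin n) (AdeleRing (𝓞 F) F)))ᵀ := by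
    rw [h1]
  have h3 : adelicAbsDet n F (trInv a)⁻¹ = adelicAbsDet n F a := by
    rw [adelicAbsDet_apply, adelicAbsDet_apply]
    exact congrArg (IdeleClassGroup.ideleNorm F)
      (Units.ext (by rw [Matrix.GeneralLinearGroup.val_det_apply, Matrix.GeneralLinearGroup.val_det_apply, h2,
        Matrix.det_transpose]))
  rw [h3, h2, Matrix.transpose_transpose]

end Levi

/-! ### The Weyl–Levi relation: the Fourier transform of a twist -/

section Fourier

/-- **The Fourier transform of a twist** (function level): `𝓕(Φ(· g))(η) = |det g|_𝔸⁻¹ · (𝓕Φ)(η (g⁻¹)ᵀ)`,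
i.e. `𝓕 ∘ d(g) = |det g|_𝔸⁻¹ · d((g⁻¹)ᵀ) ∘ 𝓕` with `d(g)Φ = Φ(· g)` — the tree's `adelicPiFourier_comp_vecMul`
rewritten with the contragredient `trInv g = (g⁻¹)ᵀ` acting on ROW vectors. This is Weil's relation
`w d(g) w⁻¹ = d((gᵀ)⁻¹)` (up to the module) between the Weyl element `w ↦ 𝓕` and the Levi factor.
[cite: Weil1964, Chap. I n° 13 and n° 34] -/
theorem adelicPiFourier_twist (g : GL (Fin n) (AdeleRing (𝓞 F) F))
    (Φ : (Fin n → AdeleRing (𝓞 F) F) → ℂ) :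
    adelicPiFourier F (Fin n) ν (twist F g Φ) =
      ((adelicAbsDet n F g⁻¹ : ℝ≥0) : ℂ) • twist F (trInv g) (adelicPiFourier F (Fin n) ν Φ) := by
  funext η
  rw [Pi.smul_apply, smul_eq_mul, twist_apply, coe_trInv, Matrix.vecMul_transpose]
  exact adelicPiFourier_comp_vecMul ν Φ g η

/-- **The Weyl–Levi relation on `𝒮(𝔸_Fⁿ)`** (operator level): `𝓕 ∘ d(g) = |det g|_𝔸⁻¹ · d((g⁻¹)ᵀ) ∘ 𝓕` for the
endomorphisms `fourierLM` and `twistLM` of `piSchwartzBruhat F (Fin n)`. [cite: Weil1964, Chap. I n° 13 and n° 34] -/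
theorem fourierLM_twistLM (g : GL (Fin n) (AdeleRing (𝓞 F) F)) (Φ : piSchwartzBruhat F (Fin n)) :
    fourierLM F (Fin n) ν (twistLM F g Φ) =
      ((adelicAbsDet n F g⁻¹ : ℝ≥0) : ℂ) • twistLM F (trInv g) (fourierLM F (Fin n) ν Φ) := by
  apply Subtype.ext
  rw [coe_fourierLM, coe_twistLM, adelicPiFourier_twist, Submodule.coe_smul, coe_twistLM, coe_fourierLM]

/-- The Weyl–Levi relation as a commutation of endomorphisms:
`fourierLM ∘ₗ twistLM g = |det g|_𝔸⁻¹ • (twistLM (g⁻¹)ᵀ ∘ₗ fourierLM)`. [cite: Weil1964, Chap. I n° 13 and n° 34] -/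
theorem fourierLM_comp_twistLM (g : GL (Fin n) (AdeleRing (𝓞 F) F)) :
    fourierLM F (Fin n) ν ∘ₗ twistLM F g =
      ((adelicAbsDet n F g⁻¹ : ℝ≥0) : ℂ) • (twistLM F (trInv g) ∘ₗ fourierLM F (Fin n) ν) :=
  LinearMap.ext fun Φ => fourierLM_twistLM F ν g Φ

omit [MeasurableSpace (AdeleRing (𝓞 F) F)] [BorelSpace (AdeleRing (𝓞 F) F)] [ν.IsAddHaarMeasure] in
/-- `d(h)` and `t(S)` on `𝒮(𝔸_Fⁿ)` (operator level): `twistLM g ∘ₗ chirpLM S = chirpLM (g S gᵀ) ∘ₗ twistLM g` —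
Weil's `d(g)⁻¹ t(S) d(g) = t(g S gᵀ)`, the tree's `twist_chirp` lifted to endomorphisms. [cite: Weil1964, Chap. I n° 34 p. 182–184] -/
theorem twistLM_comp_chirpLM (g : GL (Fin n) (AdeleRing (𝓞 F) F)) (S : Matrix (Fin n) (Fin n) (AdeleRing (𝓞 F) F)) :
    twistLM F g ∘ₗ chirpLM F S =
      chirpLM F ((g : Matrix (Fin n) (Fin n) (AdeleRing (𝓞 F) F)) * S *
          ((g : Matrix (Fin n) (Fin n) (AdeleRing (𝓞 F) F)))ᵀ) ∘ₗ twistLM F g :=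
  LinearMap.ext fun Φ => Subtype.ext (by
    rw [LinearMap.comp_apply, LinearMap.comp_apply, coe_twistLM, coe_chirpLM, coe_chirpLM, coe_twistLM]
    exact twist_chirp g S _)

end Fourier

/-! ### The Weyl flip of a Borel translate under an `𝓕`-invariant functional -/

section WeylFlip

omit [MeasurableSpace (AdeleRing (𝓞 F) F)] [BorelSpace (AdeleRing (𝓞 F) F)] [ν.IsAddHaarMeasure] in
/-- `t(S) d(g) = d(g) t(g⁻¹ S g⁻ᵀ)` on `𝒮(𝔸_Fⁿ)` (the tree's operators `chirpLM`, `twistLM`). [cite: Weil1964, Chap. I n° 34 p. 182–184] -/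
theorem chirpLM_twistLM (g : GL (Fin n) (AdeleRing (𝓞 F) F)) (S : Matrix (Fin n) (Fin n) (AdeleRing (𝓞 F) F))
    (Φ : piSchwartzBruhat F (Fin n)) :
    chirpLM F S (twistLM F g Φ) =
      twistLM F g (chirpLM F (((g⁻¹ : GL (Fin n) (AdeleRing (𝓞 F) F)) : Matrix (Fin n) (Fin n) (AdeleRing (𝓞 F) F)) * S *
        (((g⁻¹ : GL (Fin n) (AdeleRing (𝓞 F) F)) : Matrix (Fin n) (Fin n) (AdeleRing (𝓞 F) F)))ᵀ) Φ) :=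
  Subtype.ext (by
    rw [coe_chirpLM, coe_twistLM, coe_twistLM, coe_chirpLM]
    exact chirp_twist F g S _)

/-- **The Weyl flip.** For a linear functional `L` on `𝒮(𝔸_Fⁿ)` invariant under the Fourier transform
(`L ∘ 𝓕 = L` — e.g. a theta-type distribution invariant under the Weyl element `w ↦ 𝓕`), the value on a Borel
translate `t(S) d(g) Φ` equals `|det g|_𝔸⁻¹ · L( d((g⁻¹)ᵀ) 𝓕[t(g⁻¹ S g⁻ᵀ) Φ] )`: the Levi parameter is
INVERTED (`g ↦ (g⁻¹)ᵀ`) at the cost of replacing `Φ` by the Fourier transform of a chirped `Φ`. This is the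
algebra of the reduction of the ray `|t| ≤ 1` to the ray `|t| ≥ 1` in the boundedness step of the Siegel–Weil
formula ([Weil1965] n° 51, proof of Thm. 4; at rank one `Ps = P ⊔ P w N`). [cite: Weil1965, n° 46–52] -/
theorem apply_chirpLM_twistLM_of_comp_fourierLM_eq (L : piSchwartzBruhat F (Fin n) →ₗ[ℂ] ℂ)
    (hL : L ∘ₗ fourierLM F (Fin n) ν = L) (g : GL (Fin n) (AdeleRing (𝓞 F) F))
    (S : Matrix (Fin n) (Fin n) (AdeleRing (𝓞 F) F)) (Φ : piSchwartzBruhat F (Fin n)) :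
    L (chirpLM F S (twistLM F g Φ)) =
      ((adelicAbsDet n F g⁻¹ : ℝ≥0) : ℂ) *
        L (twistLM F (trInv g) (fourierLM F (Fin n) ν
          (chirpLM F (((g⁻¹ : GL (Fin n) (AdeleRing (𝓞 F) F)) : Matrix (Fin n) (Fin n) (AdeleRing (𝓞 F) F)) * S *
            (((g⁻¹ : GL (Fin n) (AdeleRing (𝓞 F) F)) : Matrix (Fin n) (Fin n) (AdeleRing (𝓞 F) F)))ᵀ) Φ))) := by
  have h1 : ∀ Ψ : piSchwartzBruhat F (Fin n), L Ψ = L (fourierLM F (Fin n) ν Ψ) := fun Ψ => by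
    conv_lhs => rw [← hL]
    rfl
  rw [chirpLM_twistLM, h1 (twistLM F g _), fourierLM_twistLM, map_smul, smul_eq_mul]

end WeylFlip

end Literature.NumberTheory.Weil1964
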